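import Summits.BirchSwinnertonDyer.Rank1Residual.Additive.X3BranchMainConjectureGordOfFacts
import Summits.BirchSwinnertonDyer.Rank1Residual.Additive.X3BranchAnalyticHalfGordDescentEndState
import Summits.BirchSwinnertonDyer.Rank1Residual.X2.GreenbergVatsalCaseOne
import HarnessLib

/-!
# X3 on the semistable-twist locus, cell (G-ord, `e = 2`), `p ≥ 5`, `r_an = 0`: the `T = 0` lower
# inputs, `MissingLowerBoundAt W p` and Miller's `BSD(E,p)` from PUBLISHED named facts ONLY + the
# per-pair line datum (cell `bsd-addord`, seat `bsd-addord-twist`, strategy = twist transport; the END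
# STATE of T-X3-χ; sequel of `X3BranchMainConjectureGordOfFacts.lean`)

HONEST FRAMING (cell `bsd-addord`, `run/shared/lean/pub/bsd-addord/README.md` §4): the programme's
target of record is the full Birch–Swinnerton-Dyer formula for every `E/ℚ` of analytic rank `≤ 1`;
this file concerns the X3 rows (`E[p]` reducible) of cell (G-ord, `e = 2`) of N10 at `p ≥ 5`,
`r_an = 0`, non-CM, off the anomalous rows, ON THE BRANCH-PARITY LINE POSITION (the per-pair line
datum `Φ₀`: a rational line RAMIFIED at `p`, EVEN, whose `χ_{p*}`-twist is ramified at `p`). THEOREMS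
ONLY (no `def`, no named fact, no `sorry`). EVERY hypothesis that is not a class/line binder is a
PUBLISHED named fact of the tree, displayed: `hW16` (Wuthrich 2014 Thm. 16), `hGV` (GV 2000 Thm.
(3.12) on the branch, reading-fact p396718), `h23` (GV 2000 §2 Cor. (2.3) + Prop. (2.4) at the datum),
`h414` (Greenberg 1999 Prop. 4.14), `hGrK` (Greenberg 1999 Props. 2.2/2.4), `hLiftF` (GV 2000
p. 28/30), `hDel` / `hDel98` (Delbourgo 2002 (A)+(B) / 1998 Prop. 4), `hGZK` (Gross–Zagier–Kolyvagin),
`hmod` / `hmodD` (modularity). No OPEN hypothesis remains on these rows. This file books nothing by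
itself (bookings are the planner's / referee's call).

## What

From the sibling's `X3Branch.charIdeal_eq_span_of_facts` / `X3Branch.chiBranchLowerDivisibilityAt_of_facts`
(the `W`-level branch main conjecture from print + the line datum), the end states of
`X3BranchAnalyticHalfGordDescentEndState.lean` re-derived WITHOUT the open count:

* `ClassX3Gord.chiBranchLowerLeadingTermAt_of_facts` (`p ≡ 1 (mod 4)`),
  `ClassX3Gord.chiBranchLowerLeadingTermOddAt_of_facts` (`p ≡ 3 (mod 4)`) — additive-p2's `T = 0` LOWER
  inputs; `ClassX3Gord.cycLowerLeadingTermAt_of_facts` — `CycLowerLeadingTermAt W p` (odd `p`,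
  rank-free; Birch + Pal transport, Pal = the tree's `_holds`);
* **`ClassX3Gord.missingLowerBoundAt_rankZero_of_facts_of_nonAnomalous`** — the N10 decl of record
  `Typed.MissingLowerBoundAt W p` (`p ≥ 5`, `r_an = 0`, non-CM, non-anomalous);
* **`ClassX3Gord.bsdp_rankZero_of_facts_of_nonAnomalous`** — Miller's `BSD(E,p)` on the same rows.
`Σ₀ :=` the bad places `≠ p` (`exists_finset_bad_not_mem`).

## What this is NOT

Not the degenerate / `Φ₀`-unramified rows at `p = 3`; not the (M) cell; not the other branch parity;
not rank `1`; not `p = 2`. The line datum `Φ₀` stays per pair (census v2 / App. F of the seat memo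
list a Case-1 member of every content class; isogenous members follow by Cassels).

References: [GreenbergVatsal2000] §2 (11), (16), §3 Thm. (3.12) p. 45; [Wuthrich2014] Thm. 16,
Cor. 18; [GreenbergLNM1716] Props. 2.2, 2.4, 4.14; [Delbourgo2002] Thm. (A), (B); [Delbourgo1998]
Prop. 4; [Pal2012] Thm. 3.2; [MazurTateTeitelbaum1986Invent] §I.13–I.14; [Miller2011LMS] Def. 1.1.
-/

set_option autoImplicit false

noncomputable section

open scoped Classical MatrixGroups ModularForm

namespace Summit.BirchSwinnertonDyer.Rank1Residual.Additive

open CongruenceSubgroup WeierstrassCurve NumberField IsDedekindDomain Field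
  Literature.NumberTheory.EllipticCurves
  Literature.NumberTheory.EllipticCurves.ModularForms
  Literature.NumberTheory.EllipticCurves.GreenbergVatsal2000
  Literature.NumberTheory.EllipticCurves.Rank1Residual
  Literature.NumberTheory.EllipticCurves.Rank1Residual.Typed
  Literature.NumberTheory.GaloisRepresentations
  Summit.BirchSwinnertonDyer.Rank1Residual.X1.MuLambda
  Summit.BirchSwinnertonDyer.Rank1Residual.AdditivePotMult
  Summit.BirchSwinnertonDyer.Rank1Residual.Additive.X3Branch

/-! ### END STATE on X3♯(G-ord) ∩ `I₀*` (`e = 2`) from PUBLISHED facts + the line data -/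

section EndState

variable {W : WeierstrassCurve ℚ} [W.IsElliptic] [W.IsGloballyMinimal] {p : ℕ} [hp : Fact p.Prime]

/-- **`p ≡ 1 (mod 4)`, type (G)-ordinary: the `T = 0` LOWER input `ChiBranchLowerLeadingTermAt W p`
from PUBLISHED facts + the line data.** [cite: MazurTateTeitelbaum1986Invent, §I.14]
[cite: GreenbergVatsal2000, §3 Thm. (3.12) p. 45] [cite: Wuthrich2014, Thm. 16 (p. 397)] -/
theorem ClassX3Gord.chiBranchLowerLeadingTermAt_of_facts
    (hW16 : Wuthrich2014.thm16_halfEigenCharIdeal_dvd_cyclotomicPrime)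
    (hGV : thm312_branch_unitContent_and_lambda_eq_residual_goodOrd)
    (h23 : datumSelmer_nonPrimitive_invariants)
    (h414 : Greenberg1999.prop414_noFiniteSubmodule_of_not_dvd_torsionOrder)
    (hGrK : Greenberg1999.imKummer_ge_strictCondition_goodOrdinary)
    (hLiftF : residualEpsilon_surjOn_of_lineRamifiedEven) (hG : TypeGOrd W p)
    (Φ₀ : AddSubgroup (W.geomTorsion (p : ℤ))) (hΦ : IsRationalLine W p Φ₀)
    (hram0 : ¬ LineUnramifiedAt W p Φ₀) (heven : LineEven W p Φ₀)
    (hram : ∀ (K : Type) [Field K] [NumberField K] [(galRange (K := ℚ) K).Normal],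
      Module.finrank ℚ K = 2 → (∃ θ : K, θ ^ 2 = algebraMap ℚ K ((-1) ^ (p / 2) * p)) →
      ¬ ∀ v : HeightOneSpectrum (𝓞 ℚ), ((p : ℕ) : 𝓞 ℚ) ∈ v.asIdeal →
        ∀ 𝔓 ∈ v.primesAbove, ∀ σ ∈ 𝔓.inertia (absoluteGaloisGroup ℚ), ∀ P ∈ Φ₀,
          σ • P = (if σ ∈ galRange (K := ℚ) K then P else -P)) :
    ChiBranchLowerLeadingTermAt W p := by
  obtain ⟨S₀, hS₀, hS⟩ := X2.GreenbergVatsalCaseOne.exists_finset_bad_not_mem W p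
  exact chiBranchLowerLeadingTermAt_of_divisibility_of_padicValRat_j_nonneg p W
    (padicValRat_j_nonneg_of_typeGOrd W p hG)
    (X3Branch.chiBranchLowerDivisibilityAt_of_facts hW16 hGV h23 h414 hGrK hLiftF S₀ hS₀ hS Φ₀ hΦ hram0
      heven hram)

/-- **`p ≡ 3 (mod 4)`, additive (G)-ordinary of defect `2`: the ODD `T = 0` LOWER input
`ChiBranchLowerLeadingTermOddAt W p` from PUBLISHED facts + the line data** (every twist model is good
ordinary, `TypeGOrd.goodOrd_of_pStar_twist_model`; §2 on the MINUS branch; additive-p2's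
`exists_padicInt_constantCoeff_eq_of_iwasawaToPowerSeries_eq_mul_minusBranch`).
[cite: MazurTateTeitelbaum1986Invent, §I.13–I.14] [cite: GreenbergVatsal2000, §3 Thm. (3.12) p. 45]
[cite: Wuthrich2014, Thm. 16 (p. 397)] -/
theorem ClassX3Gord.chiBranchLowerLeadingTermOddAt_of_facts
    (hW16 : Wuthrich2014.thm16_halfEigenCharIdeal_dvd_cyclotomicPrime)
    (hGV : thm312_branch_unitContent_and_lambda_eq_residual_goodOrd)
    (h23 : datumSelmer_nonPrimitive_invariants)
    (h414 : Greenberg1999.prop414_noFiniteSubmodule_of_not_dvd_torsionOrder)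
    (hGrK : Greenberg1999.imKummer_ge_strictCondition_goodOrdinary)
    (hLiftF : residualEpsilon_surjOn_of_lineRamifiedEven)
    (hG : TypeGOrd W p) (hadd : Addv W p) (he : semistabilityIndex W p = 2)
    (Φ₀ : AddSubgroup (W.geomTorsion (p : ℤ))) (hΦ : IsRationalLine W p Φ₀)
    (hram0 : ¬ LineUnramifiedAt W p Φ₀) (heven : LineEven W p Φ₀)
    (hram : ∀ (K : Type) [Field K] [NumberField K] [(galRange (K := ℚ) K).Normal],
      Module.finrank ℚ K = 2 → (∃ θ : K, θ ^ 2 = algebraMap ℚ K ((-1) ^ (p / 2) * p)) →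
      ¬ ∀ v : HeightOneSpectrum (𝓞 ℚ), ((p : ℕ) : 𝓞 ℚ) ∈ v.asIdeal →
        ∀ 𝔓 ∈ v.primesAbove, ∀ σ ∈ 𝔓.inertia (absoluteGaloisGroup ℚ), ∀ P ∈ Φ₀,
          σ • P = (if σ ∈ galRange (K := ℚ) K then P else -P)) :
    ChiBranchLowerLeadingTermOddAt W p := by
  obtain ⟨S₀, hS₀, hS⟩ := X2.GreenbergVatsalCaseOne.exists_finset_bad_not_mem W p
  intro V _ _ κ γ N _ f hp3 hCW hred hκ hγ hcv hf D ϖ hϖ g hg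
  have hp2 : p ≠ 2 := by omega
  have hodd : ¬ Even (p / 2) := by rw [Nat.not_even_iff_odd]; exact ⟨p / 4, by omega⟩
  obtain ⟨C, hC⟩ := hCW
  have hC' : C • V.quadraticTwist ((-1) ^ (p / 2) * p : ℚ) = W := by
    rw [pStar_eq_neg_of_mod_four_eq_three hp3]; exact hC
  have hgood : GoodOrd V p := TypeGOrd.goodOrd_of_pStar_twist_model hp2 hG hadd he ⟨C, hC'⟩
  have hord : IsOrdinaryAt V p := (isOrdinaryAt_iff V p).mpr ⟨hgood.1, hgood.2⟩
  obtain ⟨-, g', hchar, u, hι⟩ := X3Branch.charIdeal_eq_span_of_facts hW16 hGV h23 h414 hGrK hLiftF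
    hp2 hgood hC' S₀ hS₀ hS Φ₀ hΦ hram0 heven hram hκ hγ hcv hf D ϖ (by rw [if_neg hodd]; exact hϖ)
  rw [if_neg hodd] at hι
  have hg' : g ∈ Ideal.span ({g'} : Set (IwasawaAlgebra p)) := by rw [← hchar]; exact hg
  obtain ⟨a, rfl⟩ := Ideal.mem_span_singleton'.mp hg'
  have hCu : PowerSeries.C ((((u : ℤ_[p]) : ℚ_[p])) * (ϖ : ℚ_[p])) =
      PowerSeries.C (((u : ℤ_[p]) : ℚ_[p])) * PowerSeries.C (ϖ : ℚ_[p]) := map_mul _ _ _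
  have hιg : iwasawaToPowerSeries p (a * g') =
      iwasawaToPowerSeries p (PowerSeries.C (u : ℤ_[p]) * a) *
        (PowerSeries.C ((ϖ : ℚ) : ℚ_[p]) *
          padicLFunctionMinusBranch f (unitRoot V p : ℚ_[p]) (p / 2)) := by
    rw [map_mul, hι, iwasawaToPowerSeries_C_mul', hCu]
    ring
  exact exists_padicInt_constantCoeff_eq_of_iwasawaToPowerSeries_eq_mul_minusBranch p hp2 V hord hf hιg

/-- **X3♯(G-ord) ∩ `I₀*` (`e = 2`), every odd `p`: the cyclotomic `T = 0` LOWER input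
`CycLowerLeadingTermAt W p`** ("for every generator `f` of `char_Λ X(E/ℚ_∞)`, `L(E,1)/Ω_E ∣ f(0)`")
**from PUBLISHED facts + the line data** (Birch + Pal transport, Pal = the tree's `_holds`). Rank-free.
[cite: Pal2012, Thm. 3.2] [cite: MazurTateTeitelbaum1986Invent, §I.13–I.14]
[cite: GreenbergVatsal2000, §3 Thm. (3.12) p. 45] [cite: Wuthrich2014, Thm. 16 (p. 397)] -/
theorem ClassX3Gord.cycLowerLeadingTermAt_of_facts
    (hW16 : Wuthrich2014.thm16_halfEigenCharIdeal_dvd_cyclotomicPrime)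
    (hGV : thm312_branch_unitContent_and_lambda_eq_residual_goodOrd)
    (h23 : datumSelmer_nonPrimitive_invariants)
    (h414 : Greenberg1999.prop414_noFiniteSubmodule_of_not_dvd_torsionOrder)
    (hGrK : Greenberg1999.imKummer_ge_strictCondition_goodOrdinary)
    (hLiftF : residualEpsilon_surjOn_of_lineRamifiedEven)
    (hmod : hasEntireLFunction_rat) (hmodD : nonempty_modularParametrizationData)
    (hX : ClassX3Gord W p) (hp2 : p ≠ 2) (he : semistabilityIndex W p = 2)
    (Φ₀ : AddSubgroup (W.geomTorsion (p : ℤ))) (hΦ : IsRationalLine W p Φ₀)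
    (hram0 : ¬ LineUnramifiedAt W p Φ₀) (heven : LineEven W p Φ₀)
    (hram : ∀ (K : Type) [Field K] [NumberField K] [(galRange (K := ℚ) K).Normal],
      Module.finrank ℚ K = 2 → (∃ θ : K, θ ^ 2 = algebraMap ℚ K ((-1) ^ (p / 2) * p)) →
      ¬ ∀ v : HeightOneSpectrum (𝓞 ℚ), ((p : ℕ) : 𝓞 ℚ) ∈ v.asIdeal →
        ∀ 𝔓 ∈ v.primesAbove, ∀ σ ∈ 𝔓.inertia (absoluteGaloisGroup ℚ), ∀ P ∈ Φ₀,
          σ • P = (if σ ∈ galRange (K := ℚ) K then P else -P)) :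
    CycLowerLeadingTermAt W p := by
  have hodd := hp.out.eq_two_or_odd'
  by_cases hp4 : p % 4 = 1
  · exact (cycLowerLeadingTermAt_iff_chiBranchLower_of_typeGOrd_of_semistabilityIndex_eq_two W p
      pal2012_thm32_sqrt_mul_realPeriodRat_twist_eq_of_prime_one_mod_four_holds hmod hmodD hp4 hX.addv
      hX.typeGOrd he).mpr
      (ClassX3Gord.chiBranchLowerLeadingTermAt_of_facts hW16 hGV h23 h414 hGrK hLiftF hX.typeGOrd Φ₀ hΦ
        hram0 heven hram)
  · have hp4' : p % 4 = 3 := by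
      rcases hodd with h | h
      · exact absurd h hp2
      · obtain ⟨k, hk⟩ := h; omega
    exact (cycLowerLeadingTermAt_iff_chiBranchLowerOdd_of_typeGOrd_of_semistabilityIndex_eq_two W p
      hmod hmodD hp4' hX.addv hX.typeGOrd he).mpr
      (ClassX3Gord.chiBranchLowerLeadingTermOddAt_of_facts hW16 hGV h23 h414 hGrK hLiftF hX.typeGOrd
        hX.addv he Φ₀ hΦ hram0 heven hram)

/-- **X3♯(G-ord) ∩ `I₀*`, `p ≥ 5`, `r_an = 0`, non-CM, OFF the anomalous rows, on the branch-parity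
line position: the N10 decl of record `Typed.MissingLowerBoundAt W p` FROM PUBLISHED FACTS ONLY** +
the per-pair line datum `Φ₀` (rational, ramified at `p`, even, `χ`-twist ramified; `Σ₀ :=` the bad places `≠ p`). No open
hypothesis: `hW16`, `hGV`, `h23`, `h414`, `hGrK`, `hLiftF`, `hDel`, `hGZK`, `hmod`, `hmodD` are all
published records of the tree. T-X3-χ with analytic half, twist descent AND algebraic count in the
kernel. Nothing is booked by this file (planner's call).
[cite: Delbourgo2002, Theorem (A), (B) (p. 40)] [cite: Pal2012, Thm. 3.2]
[cite: GreenbergVatsal2000, §2 (11), (16), §3 Thm. (3.12) p. 45] [cite: Wuthrich2014, Thm. 16 (p. 397)]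
[cite: GreenbergLNM1716, Props. 2.2, 2.4, 4.14] [cite: Miller2011LMS, Def. 1.1] -/
theorem ClassX3Gord.missingLowerBoundAt_rankZero_of_facts_of_nonAnomalous
    (hW16 : Wuthrich2014.thm16_halfEigenCharIdeal_dvd_cyclotomicPrime)
    (hGV : thm312_branch_unitContent_and_lambda_eq_residual_goodOrd)
    (h23 : datumSelmer_nonPrimitive_invariants)
    (h414 : Greenberg1999.prop414_noFiniteSubmodule_of_not_dvd_torsionOrder)
    (hGrK : Greenberg1999.imKummer_ge_strictCondition_goodOrdinary)
    (hLiftF : residualEpsilon_surjOn_of_lineRamifiedEven)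
    (hDel : Delbourgo2002.mainTheorem)
    (hGZK : rank_eq_analyticRank_of_analyticRank_le_one) (hmod : hasEntireLFunction_rat)
    (hmodD : nonempty_modularParametrizationData)
    (hX : ClassX3Gord W p) (hcm : ¬ W.HasCM) (hp5 : 5 ≤ p) (he : semistabilityIndex W p = 2)
    (hr : W.analyticRank = 0) (hna : Delbourgo2002.ReductionNonAnomalous W p)
    (Φ₀ : AddSubgroup (W.geomTorsion (p : ℤ))) (hΦ : IsRationalLine W p Φ₀)
    (hram0 : ¬ LineUnramifiedAt W p Φ₀) (heven : LineEven W p Φ₀)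
    (hram : ∀ (K : Type) [Field K] [NumberField K] [(galRange (K := ℚ) K).Normal],
      Module.finrank ℚ K = 2 → (∃ θ : K, θ ^ 2 = algebraMap ℚ K ((-1) ^ (p / 2) * p)) →
      ¬ ∀ v : HeightOneSpectrum (𝓞 ℚ), ((p : ℕ) : 𝓞 ℚ) ∈ v.asIdeal →
        ∀ 𝔓 ∈ v.primesAbove, ∀ σ ∈ 𝔓.inertia (absoluteGaloisGroup ℚ), ∀ P ∈ Φ₀,
          σ • P = (if σ ∈ galRange (K := ℚ) K then P else -P)) :
    MissingLowerBoundAt W p :=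
  ClassX3Gord.missingLowerBoundAt_rankZero_of_cycLower_of_nonAnomalous hDel hGZK hmod hX hcm hp5 hr
    (ClassX3Gord.cycLowerLeadingTermAt_of_facts hW16 hGV h23 h414 hGrK hLiftF hmod hmodD hX (by omega) he
      Φ₀ hΦ hram0 heven hram) hna

/-- **X3♯(G-ord) ∩ `I₀*`, `p ≥ 5`, `r_an = 0`, non-CM, OFF the anomalous rows, on the branch-parity
line position: Miller's `BSD(E,p)` FROM PUBLISHED FACTS ONLY** + the per-pair line datum `Φ₀`.
Lower half as in the previous theorem; upper half = the Wuthrich component chain (additive-p2's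
`ClassX3Gord.bsdp_rankZero_of_cycLower_of_wuthrichComponent`, over the component reading derived from
`hW16`) with Delbourgo 1998 Prop. 4 (`hDel98`). No image, Tamagawa, Manin or `#Ш_an` hypothesis; no
open hypothesis. Nothing is booked by this file (planner's call).
[cite: Delbourgo2002, Theorem (A), (B) (p. 40)] [cite: Delbourgo1998, Prop. 4 (p. 144)]
[cite: Wuthrich2014, Thm. 16 (p. 397), Cor. 18] [cite: GreenbergVatsal2000, §2 (11), (16), §3 Thm. (3.12) p. 45]
[cite: GreenbergLNM1716, Props. 2.2, 2.4, 4.14] [cite: Pal2012, Thm. 3.2] [cite: Miller2011LMS, §1 and Def. 1.1] -/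
theorem ClassX3Gord.bsdp_rankZero_of_facts_of_nonAnomalous
    (hW16 : Wuthrich2014.thm16_halfEigenCharIdeal_dvd_cyclotomicPrime)
    (hGV : thm312_branch_unitContent_and_lambda_eq_residual_goodOrd)
    (h23 : datumSelmer_nonPrimitive_invariants)
    (h414 : Greenberg1999.prop414_noFiniteSubmodule_of_not_dvd_torsionOrder)
    (hGrK : Greenberg1999.imKummer_ge_strictCondition_goodOrdinary)
    (hLiftF : residualEpsilon_surjOn_of_lineRamifiedEven)
    (hDel98 : Delbourgo1998.prop4_rankZero_pow_dvd_constantCoeff) (hDel : Delbourgo2002.mainTheorem)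
    (hGZK : rank_eq_analyticRank_of_analyticRank_le_one) (hmod : hasEntireLFunction_rat)
    (hmodD : nonempty_modularParametrizationData)
    (hX : ClassX3Gord W p) (hcm : ¬ W.HasCM) (hp5 : 5 ≤ p) (he : semistabilityIndex W p = 2)
    (hr : W.analyticRank = 0) (hna : Delbourgo2002.ReductionNonAnomalous W p)
    (Φ₀ : AddSubgroup (W.geomTorsion (p : ℤ))) (hΦ : IsRationalLine W p Φ₀)
    (hram0 : ¬ LineUnramifiedAt W p Φ₀) (heven : LineEven W p Φ₀)
    (hram : ∀ (K : Type) [Field K] [NumberField K] [(galRange (K := ℚ) K).Normal],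
      Module.finrank ℚ K = 2 → (∃ θ : K, θ ^ 2 = algebraMap ℚ K ((-1) ^ (p / 2) * p)) →
      ¬ ∀ v : HeightOneSpectrum (𝓞 ℚ), ((p : ℕ) : 𝓞 ℚ) ∈ v.asIdeal →
        ∀ 𝔓 ∈ v.primesAbove, ∀ σ ∈ 𝔓.inertia (absoluteGaloisGroup ℚ), ∀ P ∈ Φ₀,
          σ • P = (if σ ∈ galRange (K := ℚ) K then P else -P)) :
    BSDp W p :=
  ClassX3Gord.bsdp_rankZero_of_cycLower_of_wuthrichComponent
    (Wuthrich2014.charIdeal_dvd_padicLFunctionBranch_component_of_half hW16)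
    pal2012_thm32_sqrt_mul_realPeriodRat_twist_eq_of_prime_one_mod_four_holds hDel98 hDel hGZK hmod
    hmodD hX hcm hp5 he hr
    (ClassX3Gord.cycLowerLeadingTermAt_of_facts hW16 hGV h23 h414 hGrK hLiftF hmod hmodD hX (by omega) he
      Φ₀ hΦ hram0 heven hram) hna

end EndState
end Summit.BirchSwinnertonDyer.Rank1Residual.Additive

end
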